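import Literature.AnabelianGeometry.EtaleTheta.Thm110HypothesisRefl
import HarnessLib

/-!
# [EtTh] §1, Prop. 1.8 / Thm. 1.10 (ii) as SCHEMATA over `MuTwoSetting`: the INSTANCE FORMS that hold
# (inner automorphisms, restrictions, groupoid laws; identity transport)

Mochizuki, *The étale theta function …*, Publ. RIMS **45** (2009), §1, Prop. 1.8 p. 28, Thm. 1.10 (ii)
pp. 29–30 (printed 254–256) [cite: MochizukiEtTh2009, Thm 1.10 (ii) p.30]. abc-iut cell, block F
(fact-proving wave, LADDER-ABC:A2.C), seat abc-iut-f-114, FACT-LIST rows F-2483 `PreservesCoverings`,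
F-1396 `Prop18`, F-0514 `Thm110ii` of `ConstantMultipleRigidity.lean` (abc-iut-L2-t1). Companion of
`Sec1Prop18SchemaCensus.lean` (where the universal closures of `Prop18` / `PreservesCoverings` are
REFUTED). PROOF-ONLY: no `def`, no instance, no new named fact; the trunk file, `Discharge/Sec1Prop18`,
`Sec1CompatHolds`, `TemperedRigidityValuation` and `Thm110HypothesisRefl` are imported, never edited.

Rule R5: the rows are schemata, consumable AT NAMED INSTANCES. The instances at which they hold by the
group theory of Def. 1.7 alone (no anabelian input) are recorded here:

**(C) `PreservesCoverings` / `Prop18`.** `PreservesCoverings ε ε Γ` for every INNER automorphism `Γ` of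
`Π^tp_C` by an element of `Π^tp_X` (`preservesCoverings_of_inner`: `Π^tp_X, Π^tp_Ẍ, Π^tp_Ẋ, Π^tp_Ċ ⊴ Π^tp_C`
by `Gal(Ẍ/C) ≅ (ℤ/2ℤ)³`, and `Π^tp_Ÿ ⊴ Π^tp_X` by `ThetaSetting.compat`) — the instance at which Prop. 1.8's
"commutative diagrams of OUTER homomorphisms" (p. 28) are tautologically preserved; closure under
`symm`/`trans` (`PreservesCoverings.symm'`, `.trans'`). `Prop18` for every `γ` that IS the restriction of
a covering-preserving `Γ` (`prop18_of_preservesCoverings_restrict`), at `γ = id` (`prop18_refl`), for the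
restrictions of inner automorphisms (`prop18_of_inner`), and closure under `symm`/`trans` (`Prop18.symm'`,
`Prop18.trans'`): the `γ` satisfying the typed conclusion of Prop. 1.8 form a groupoid containing the
restrictions of diagram isomorphisms — and (census file) nothing in the interface puts any other `γ` in it.

**(D) Thm. 1.10 (ii)** (`Thm110ii H Sα Sβ`: "the isomorphism `K^×_α →̃ K^×_β` … induced by `γ` preserves
the standard sets of values of `η̈^{Θ,Z}`", p. 30) holds with `δ := id` for every hypothesis package `H`
whose induced cohomology transport on `H¹(Π^tp_Ÿ, Δ_Θ)` is the identity, with equal standard data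
(`thm110ii_of_transport_eq_self`), in particular whenever `γ_X = id` (`thm110ii_of_γX_eq_refl`: companions
of the identity are trivial, `transport_refl`) and at the identity witness of `Thm110Hypothesis`
(`exists_thm110Hypothesis_γX_eq_refl`, `exists_thm110Hypothesis_thm110ii`). No kernel refutation of the
universal closure of `Thm110ii` is available: every instance needs an étale theta datum
`E : EtaleThetaData` and Def-1.9 standard data `S` (the points `τ, τ⁻¹` of `Ÿ`), which have no producer
at the models (`StandardDataModelNonVacuity`); the general case is abc-iut-w5-d140's sub-DAG
(`ConstantMultipleRigiditySub`: `thm110ii_of_valuesForward` ⇐ [SemiAnbd] Thm. 6.8 (iii) + the naturality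
of evaluation at points, interface-invisible since `NonCuspidalPoint.evalAt` is free data).

HONEST FRAMING: instance forms of OUR typed schemata; typed ≠ proved for [EtTh]; no side is taken on
[IUTchIII] Cor. 3.12 or on any author.
-/

noncomputable section

namespace Literature.AnabelianGeometry.EtaleTheta

open Literature.AnabelianGeometry.SemiGraphs

namespace MuTwoSetting

variable {p : ℕ} [Fact p.Prime] (M : MuTwoSetting p)

/-! ## (C) Instance forms that hold: inner automorphisms, restrictions, and the groupoid laws -/

/-- An isomorphism that is conjugation by `g` carries a normal subgroup onto itself. [folklore] -/
private theorem map_eq_self_of_inner {G : Type*} [Group G] {H : Subgroup G} [hn : H.Normal]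
    (Γ : G ≃* G) {g : G} (hΓ : ∀ x, Γ x = g * x * g⁻¹) : H.map Γ.toMonoidHom = H := by
  ext y
  constructor
  · rintro ⟨x, hx, rfl⟩
    change Γ x ∈ H
    rw [hΓ]
    exact hn.conj_mem x hx g
  · intro hy
    refine ⟨g⁻¹ * y * g, ?_, ?_⟩
    · have := hn.conj_mem y hy g⁻¹
      rwa [inv_inv] at this
    · change Γ (g⁻¹ * y * g) = y
      rw [hΓ]
      group

/-- **`PreservesCoverings` holds for every INNER automorphism of `Π^tp_C` by an element of `Π^tp_X`** (same
`ε_Z` on both sides): `Π^tp_X`, `Π^tp_Ẍ`, `Π^tp_Ẋ`, `Π^tp_Ċ` are normal in `Π^tp_C` (Def. 1.7, `Gal(Ẍ/C) ≅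
(ℤ/2ℤ)³`), and `Π^tp_Ÿ` is normal in `Π^tp_X` (`ThetaSetting.compat`). This is the instance at which the
"commutative diagrams of OUTER homomorphisms" of Prop. 1.8 (p. 28) are tautologically preserved.
[cite: MochizukiEtTh2009, Prop 1.8 p.28] -/
theorem preservesCoverings_of_inner (εZ : M.GtpC) (Γ : M.GtpC ≃ₜ* M.GtpC) {σ : M.PiTemp}
    (hΓ : ∀ x, Γ.toMulEquiv x = M.inclX σ * x * (M.inclX σ)⁻¹) : PreservesCoverings εZ εZ Γ := by
  haveI := M.map_GtpXdd_normal
  haveI := M.range_inclX_normal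
  haveI := M.dotX_normal εZ
  haveI := M.dotC_normal εZ
  haveI := M.toThetaSetting.compat.GtpYdd_normal
  refine ⟨?_, map_eq_self_of_inner Γ.toMulEquiv hΓ, map_eq_self_of_inner Γ.toMulEquiv hΓ,
    map_eq_self_of_inner Γ.toMulEquiv hΓ, map_eq_self_of_inner Γ.toMulEquiv hΓ⟩
  -- `Π^tp_Ÿ`: conjugate inside `Π^tp_X`, where it is normal
  ext y
  constructor
  · rintro ⟨_, ⟨x, hx, rfl⟩, rfl⟩
    refine ⟨σ * x * σ⁻¹, Subgroup.Normal.conj_mem inferInstance x hx σ, ?_⟩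
    change M.inclX (σ * x * σ⁻¹) = Γ.toMulEquiv (M.inclX x)
    rw [hΓ, map_mul, map_mul, map_inv]
  · rintro ⟨x, hx, rfl⟩
    refine ⟨M.inclX (σ⁻¹ * x * σ), ⟨σ⁻¹ * x * σ, ?_, rfl⟩, ?_⟩
    · have := Subgroup.Normal.conj_mem inferInstance x hx σ⁻¹
      rwa [inv_inv] at this
    · change Γ.toMulEquiv (M.inclX (σ⁻¹ * x * σ)) = M.inclX x
      rw [hΓ, map_mul, map_mul, map_inv]
      group

end MuTwoSetting

section Groupoid

variable {p : ℕ} [Fact p.Prime] {Mα Mβ Mγ : MuTwoSetting p}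
  {εα : Mα.GtpC} {εβ : Mβ.GtpC} {εγ : Mγ.GtpC}

/-- Images under the composite of two continuous isomorphisms. [folklore] -/
private theorem map_trans_eq {G₁ G₂ G₃ : Type*} [Group G₁] [Group G₂] [Group G₃] [TopologicalSpace G₁]
    [TopologicalSpace G₂] [TopologicalSpace G₃] (Γ : G₁ ≃ₜ* G₂) (Γ' : G₂ ≃ₜ* G₃) (H : Subgroup G₁) :
    H.map (Γ.trans Γ').toMulEquiv.toMonoidHom = (H.map Γ.toMulEquiv.toMonoidHom).map Γ'.toMulEquiv.toMonoidHom := by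
  rw [Subgroup.map_map]
  rfl

/-- Images under the inverse of a continuous isomorphism. [folklore] -/
private theorem map_symm_eq_of_map_eq {G₁ G₂ : Type*} [Group G₁] [Group G₂] [TopologicalSpace G₁]
    [TopologicalSpace G₂] (Γ : G₁ ≃ₜ* G₂) {H : Subgroup G₁} {H' : Subgroup G₂}
    (h : H.map Γ.toMulEquiv.toMonoidHom = H') : H'.map Γ.symm.toMulEquiv.toMonoidHom = H := by
  rw [← h, Subgroup.map_map]
  have : Γ.symm.toMulEquiv.toMonoidHom.comp Γ.toMulEquiv.toMonoidHom = MonoidHom.id _ := by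
    ext x
    exact Γ.toMulEquiv.symm_apply_apply x
  rw [this, Subgroup.map_id]

/-- `PreservesCoverings` is symmetric: `Γ⁻¹` preserves the coverings backwards. [cite: MochizukiEtTh2009, Prop 1.8 p.28] -/
theorem PreservesCoverings.symm' {Γ : Mα.GtpC ≃ₜ* Mβ.GtpC} (h : PreservesCoverings εα εβ Γ) :
    PreservesCoverings εβ εα Γ.symm :=
  ⟨map_symm_eq_of_map_eq Γ h.map_Ydd, map_symm_eq_of_map_eq Γ h.map_Xdd,
    map_symm_eq_of_map_eq Γ h.map_dotX, map_symm_eq_of_map_eq Γ h.map_X,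
    map_symm_eq_of_map_eq Γ h.map_dotC⟩

/-- `PreservesCoverings` is transitive. [cite: MochizukiEtTh2009, Prop 1.8 p.28] -/
theorem PreservesCoverings.trans' {Γ : Mα.GtpC ≃ₜ* Mβ.GtpC} {Γ' : Mβ.GtpC ≃ₜ* Mγ.GtpC}
    (h : PreservesCoverings εα εβ Γ) (h' : PreservesCoverings εβ εγ Γ') :
    PreservesCoverings εα εγ (Γ.trans Γ') := by
  refine ⟨?_, ?_, ?_, ?_, ?_⟩
  · rw [map_trans_eq, h.map_Ydd, h'.map_Ydd]
  · rw [map_trans_eq, h.map_Xdd, h'.map_Xdd]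
  · rw [map_trans_eq, h.map_dotX, h'.map_dotX]
  · rw [map_trans_eq, h.map_X, h'.map_X]
  · rw [map_trans_eq, h.map_dotC, h'.map_dotC]

/-- **The instance form of Prop. 1.8 that holds by construction**: if `γ : Π^tp_{Ẋα} →̃ Π^tp_{Ẋβ}` IS the
restriction of some `Γ : Π^tp_{Cα} →̃ Π^tp_{Cβ}` preserving the coverings, then `Prop18 hα hβ γ` (inner
factor `c = 1`). [cite: MochizukiEtTh2009, Prop 1.8 p.28] -/
theorem prop18_of_preservesCoverings_restrict (hα : Mα.IsAdmissibleEpsZ εα) (hβ : Mβ.IsAdmissibleEpsZ εβ)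
    (γ : Mα.dotX εα ≃ₜ* Mβ.dotX εβ) (Γ : Mα.GtpC ≃ₜ* Mβ.GtpC) (hΓ : PreservesCoverings εα εβ Γ)
    (hres : ∀ x : Mα.dotX εα, Γ.toMulEquiv x.1 = (γ.toMulEquiv x).1) : Prop18 hα hβ γ :=
  ⟨Γ, hΓ, 1, fun x => by rw [hres, one_mul, inv_one, mul_one]⟩

/-- **Prop. 1.8 at `γ = id`** (`α = β`, same `ε_Z`): `Γ := id`. [cite: MochizukiEtTh2009, Prop 1.8 p.28] -/
theorem prop18_refl {M : MuTwoSetting p} {εZ : M.GtpC} (hZ : M.IsAdmissibleEpsZ εZ) :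
    Prop18 hZ hZ (ContinuousMulEquiv.refl (M.dotX εZ)) :=
  prop18_of_preservesCoverings_restrict hZ hZ _ (ContinuousMulEquiv.refl M.GtpC)
    (M.preservesCoverings_refl εZ) fun _ => rfl

/-- **Prop. 1.8 for `γ` the restriction to `Π^tp_Ẋ` of an inner automorphism of `Π^tp_C` by an element of
`Π^tp_X`** (`α = β`): the extension is that inner automorphism (`preservesCoverings_of_inner`).
[cite: MochizukiEtTh2009, Prop 1.8 p.28] -/
theorem prop18_of_inner {M : MuTwoSetting p} {εZ : M.GtpC} (hZ : M.IsAdmissibleEpsZ εZ)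
    (γ : M.dotX εZ ≃ₜ* M.dotX εZ) (Γ : M.GtpC ≃ₜ* M.GtpC) {σ : M.PiTemp}
    (hΓ : ∀ x, Γ.toMulEquiv x = M.inclX σ * x * (M.inclX σ)⁻¹)
    (hres : ∀ x : M.dotX εZ, (γ.toMulEquiv x).1 = M.inclX σ * x.1 * (M.inclX σ)⁻¹) : Prop18 hZ hZ γ :=
  prop18_of_preservesCoverings_restrict hZ hZ γ Γ (M.preservesCoverings_of_inner εZ Γ hΓ)
    fun x => by rw [hΓ, hres]

/-- `Prop18` is symmetric in `(α, γ) ↔ (β, γ⁻¹)`. [cite: MochizukiEtTh2009, Prop 1.8 p.28] -/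
theorem Prop18.symm' {hα : Mα.IsAdmissibleEpsZ εα} {hβ : Mβ.IsAdmissibleEpsZ εβ}
    {γ : Mα.dotX εα ≃ₜ* Mβ.dotX εβ} (h : Prop18 hα hβ γ) : Prop18 hβ hα γ.symm := by
  obtain ⟨Γ, hΓ, c, hc⟩ := h
  refine ⟨Γ.symm, hΓ.symm', (Γ.toMulEquiv.symm c)⁻¹, fun y => ?_⟩
  have hy := hc (γ.toMulEquiv.symm y)
  rw [MulEquiv.apply_symm_apply] at hy
  -- `Γ (γ⁻¹ y) = c y c⁻¹`, so `Γ⁻¹ y = (Γ⁻¹ c)⁻¹ (γ⁻¹ y) (Γ⁻¹ c)`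
  apply Γ.toMulEquiv.injective
  change Γ.toMulEquiv (Γ.toMulEquiv.symm y.1) =
    Γ.toMulEquiv ((Γ.toMulEquiv.symm c)⁻¹ * (γ.toMulEquiv.symm y).1 * (Γ.toMulEquiv.symm c)⁻¹⁻¹)
  rw [inv_inv, map_mul, map_mul, map_inv, MulEquiv.apply_symm_apply, MulEquiv.apply_symm_apply, hy]
  group

/-- `Prop18` is transitive: extensions compose, the inner factors compose as `Γ'(c) · c'`.
[cite: MochizukiEtTh2009, Prop 1.8 p.28] -/
theorem Prop18.trans' {hα : Mα.IsAdmissibleEpsZ εα} {hβ : Mβ.IsAdmissibleEpsZ εβ}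
    {hγ : Mγ.IsAdmissibleEpsZ εγ} {γ : Mα.dotX εα ≃ₜ* Mβ.dotX εβ} {γ' : Mβ.dotX εβ ≃ₜ* Mγ.dotX εγ}
    (h : Prop18 hα hβ γ) (h' : Prop18 hβ hγ γ') : Prop18 hα hγ (γ.trans γ') := by
  obtain ⟨Γ, hΓ, c, hc⟩ := h
  obtain ⟨Γ', hΓ', c', hc'⟩ := h'
  refine ⟨Γ.trans Γ', hΓ.trans' hΓ', Γ'.toMulEquiv c * c', fun x => ?_⟩
  change Γ'.toMulEquiv (Γ.toMulEquiv x.1) = Γ'.toMulEquiv c * c' * (γ'.toMulEquiv (γ.toMulEquiv x)).1 *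
    (Γ'.toMulEquiv c * c')⁻¹
  rw [hc x, map_mul, map_mul, map_inv, hc' (γ.toMulEquiv x)]
  group

end Groupoid

/-! ## (D) Thm. 1.10 (ii): the instance form at the identity transport -/

section Thm110ii

variable {p : ℕ} [Fact p.Prime] {M : MuTwoSetting p} {εZ : M.GtpC} {hC : M.toThetaSetting.Compat}
  {E : M.toThetaSetting.EtaleThetaData} {γ : M.dotC εZ ≃ₜ* M.dotC εZ}

/-- **Thm. 1.10 (ii) holds with `δ := id` whenever the cohomology transport induced by the hypothesis
package is the identity** (`α = β`, same data, same standard data): "the isomorphism `K^×_α →̃ K^×_β` induced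
by `γ`" is then the identity and trivially "preserves the standard sets of values of `η̈^{Θ,Z}`" (p. 30).
[cite: MochizukiEtTh2009, Thm 1.10 (ii) p.30] -/
theorem thm110ii_of_transport_eq_self (H : Thm110Hypothesis εZ εZ hC hC E E γ)
    (hT : ∀ x, ThetaSetting.transport H.companion H.thm16i x = x) (S : M.StandardData E.toKummerData) :
    Thm110ii H S S := by
  refine ⟨MulEquiv.refl _, fun a => ?_, fun V hV => ?_⟩
  · rw [hT]
    rfl
  · have : ((MulEquiv.refl (↥M.Kdd)ˣ) '' V : Set (↥M.Kdd)ˣ) = V := by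
      ext v
      simp
    rw [this]
    exact hV

/-- **Every hypothesis package with `γ_X = id` has identity transport** (companions of the identity are
trivial, `transport_refl`), hence satisfies Thm. 1.10 (ii) with `δ := id` and equal standard data.
[cite: MochizukiEtTh2009, Thm 1.10 (ii) p.30] -/
theorem thm110ii_of_γX_eq_refl (H : Thm110Hypothesis εZ εZ hC hC E E γ)
    (hγX : H.γX = ContinuousMulEquiv.refl M.PiTemp) (S : M.StandardData E.toKummerData) :
    Thm110ii H S S := by
  have key : ∀ {γX : M.PiTemp ≃ₜ* M.PiTemp} (_ : γX = ContinuousMulEquiv.refl M.PiTemp)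
      (c : ThetaSetting.ThetaCompanion γX) (h : ThetaSetting.Thm16i γX) (x),
      ThetaSetting.transport c h x = x := by
    intro γX hγ c h x
    subst hγ
    exact ThetaSetting.transport_refl c h x
  exact thm110ii_of_transport_eq_self H (fun x => key hγX H.companion H.thm16i x) S

/-- **The identity witness of `Thm110Hypothesis`** (`γ = id`, `Γ = id`, `γ_X = id`, identity theta
companion — as in `Thm110HypothesisRefl`, here with the field `γ_X = id` exposed): for every
`MuTwoSetting`, admissible `ε_Z`, `Compat` datum and étale theta datum `E`.
[cite: MochizukiEtTh2009, Thm 1.10 p.29] -/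
theorem exists_thm110Hypothesis_γX_eq_refl (hZ : M.IsAdmissibleEpsZ εZ) (hC : M.toThetaSetting.Compat)
    (E : M.toThetaSetting.EtaleThetaData) :
    ∃ H : Thm110Hypothesis εZ εZ hC hC E E (ContinuousMulEquiv.refl (M.dotC εZ)),
      H.γX = ContinuousMulEquiv.refl M.PiTemp :=
  ⟨{ admα := hZ
     admβ := hZ
     Γ := ContinuousMulEquiv.refl M.GtpC
     preserves := M.preservesCoverings_refl εZ
     restricts := ⟨1, fun x => by rw [inv_one, mul_one, one_mul]; rfl⟩
     γX := ContinuousMulEquiv.refl M.PiTemp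
     γX_spec := fun _ => rfl
     thm16i := ThetaSetting.thm16i_refl M.toThetaSetting
     companion := ThetaSetting.ThetaCompanion.ofRefl M.toThetaSetting
     maps_orbit := fun y => by
       constructor
       · intro hy
         exact ⟨y, hy, (ThetaSetting.transport_refl _ _ y).symm⟩
       · rintro ⟨x, hx, rfl⟩
         rw [ThetaSetting.transport_refl]
         exact hx }, rfl⟩

/-- **Thm. 1.10 (ii) at the identity witness of `Thm110Hypothesis`**: for every `MuTwoSetting`, admissible
`ε_Z`, `Compat` datum, étale theta datum `E` and standard data `S` there is a hypothesis package at
`γ = id` (with `γ_X = id`) for which `Thm110ii` holds. Satisfiability of the schema relative to its data;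
the general case is abc-iut-w5-d140's `thm110ii_of_valuesForward` ⇐ [SemiAnbd] Thm. 6.8 (iii) +
naturality of evaluation at points. [cite: MochizukiEtTh2009, Thm 1.10 (ii) p.30] -/
theorem exists_thm110Hypothesis_thm110ii (hZ : M.IsAdmissibleEpsZ εZ) (hC : M.toThetaSetting.Compat)
    (E : M.toThetaSetting.EtaleThetaData) (S : M.StandardData E.toKummerData) :
    ∃ H : Thm110Hypothesis εZ εZ hC hC E E (ContinuousMulEquiv.refl (M.dotC εZ)),
      H.γX = ContinuousMulEquiv.refl M.PiTemp ∧ Thm110ii H S S := by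
  obtain ⟨H, hH⟩ := exists_thm110Hypothesis_γX_eq_refl hZ hC E
  exact ⟨H, hH, thm110ii_of_γX_eq_refl H hH S⟩

end Thm110ii

end Literature.AnabelianGeometry.EtaleTheta

end
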